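import Summits.CriticalPhenomena.SAWScalingLimit.Theorems.SAWDevelopingMapObservableToSLETypeLadderCarvedReductionSqueezeBulkHull
import Literature.Probability.RandomPlanarGeometry.ChordalBoundary
import Literature.Probability.RandomPlanarGeometry.LoewnerDescriptionProofs
import Literature.Probability.RandomPlanarGeometry.CaratheodoryHalfPlaneProofs
import HarnessLib

/-!
# Boundary toolkit for the chordal uniformizer of the super-domain (piece (T-A′₂F uniformizer)
# of stub T-A′₂F `stub_carvedReduction_squeezeGeometry_domainsCoreF`)

Crux `SAWDevelopingMap.ObservableToSLE` (stmt-CriticalPhenomena-10472), line `six-class-type-ladder`,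
stub T-A′₂F `stub_carvedReduction_squeezeGeometry_domainsCoreF`.  Landing target:
`Summits/CriticalPhenomena/SAWScalingLimit/Theorems/SAWDevelopingMapObservableToSLETypeLadderCarvedReductionSqueezeUniformizer.lean`.

The confined outer approximants `E_n` of the super-domain `E` (chordal uniformizer `φ : ℍ → E`)
are produced by T-A′₁ (`stub_carvedReduction_confinedOuterHull`) from a hull `B_n` that must be
`r_n`-DEEP inside a `*`-hull `A'_n`, real points included.  Both hulls are of the form
`closure (ℍ ∖ φ.symm '' G)` for open `G ⊆ E` (`bulkHull`), so deepness is the statement that the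
closures of `ℍ ∖ φ.symm '' Gᴮ` and of `φ.symm '' G'` are disjoint.  This file reduces that to a
EUCLIDEAN separation `dist (E ∖ Gᴮ, G') > 0` inside `E`, using Carathéodory's theorem in the
half-plane form (the tree's `JordanDomain.continuousOn_boundaryExtension_holds`,
`JordanDomain.injOn_boundaryExtension`, `JordanDomain.IsDiscExtension`):

* `exists_norm_le_of_le_dist` — properness at `∞`: `κ ≤ dist (φ w) (E.pt 1) ⇒ ‖w‖ ≤ R(κ)`;
* `boundaryExtension_ne_pt_one` — no point of `closure ℍ` is sent to `E.pt 1`;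
* `disjoint_closure_of_le_dist` — if `d ≤ dist (φ a) (φ b)` for `a ∈ U`, `b ∈ V` (`U, V ⊆ ℍ`,
  `d > 0`) then `closure U ∩ closure V = ∅` (continuity of the boundary extension);
* `exists_le_dist_image` — conversely, for `X ⊆ closure ℍ` compact and `Y ⊆ ℍ` with
  `X ∩ closure Y = ∅`: `dist (φ (X ∩ ℍ), φ Y) > 0` (continuity + injectivity + properness);
* `exists_pos_forall_le_infDist` — a compact set off a closed nonempty set is uniformly off it.
Registered carrier: `stub_carvedReduction_uniformizer`.
-/

noncomputable section

open scoped Topology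
open Filter Set Metric Bornology
open UpperHalfPlane (upperHalfPlaneSet isOpen_upperHalfPlaneSet)
open Literature.Probability.RandomPlanarGeometry

namespace Summit.CriticalPhenomena.SAWScalingLimit.Theorems.ObservableToSLE.TypeLadder

/-- A compact set disjoint from a nonempty closed set keeps a uniform positive distance from it. -/
theorem exists_pos_forall_le_infDist {K F : Set ℂ} (hK : IsCompact K) (hF : IsClosed F) (hFne : F.Nonempty)
    (hdisj : Disjoint K F) : ∃ r > (0 : ℝ), ∀ w ∈ K, r ≤ infDist w F := by
  rcases K.eq_empty_or_nonempty with rfl | hKne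
  · exact ⟨1, one_pos, fun w hw => absurd hw (notMem_empty w)⟩
  obtain ⟨w₀, hw₀, hmin⟩ := hK.exists_isMinOn hKne (continuous_infDist_pt F).continuousOn
  have hpos : 0 < infDist w₀ F :=
    (infDist_pos_iff_notMem_closure hFne).1 (by rw [hF.closure_eq]; exact Set.disjoint_left.1 hdisj hw₀)
  exact ⟨infDist w₀ F, hpos, fun w hw => hmin hw⟩

section Uniformizer

variable {E : DobrushinDomain} {φ : ConformalEquiv upperHalfPlaneSet E.carrier}

/-- **Properness of a chordal uniformizer at `∞`**: the points of `ℍ` whose images stay `κ`-away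
from `E.pt 1` form a bounded set. -/
theorem exists_norm_le_of_le_dist (hφ : E.IsChordalUniformizing φ) {κ : ℝ} (hκ : 0 < κ) :
    ∃ R : ℝ, ∀ w ∈ upperHalfPlaneSet, κ ≤ dist (φ w) (E.pt 1) → ‖w‖ ≤ R := by
  have hev : ∀ᶠ z in cocompact ℂ ⊓ 𝓟 upperHalfPlaneSet, φ z ∈ ball (E.pt 1) κ := hφ.2 (ball_mem_nhds _ hκ)
  rw [Filter.eventually_inf_principal, ← Metric.cobounded_eq_cocompact] at hev
  obtain ⟨R, -, hR⟩ := (Filter.hasBasis_cobounded_norm.eventually_iff).1 hev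
  refine ⟨R, fun w hw hκw => ?_⟩
  by_contra h
  push Not at h
  have h1 : φ w ∈ ball (E.pt 1) κ := hR h.le hw
  rw [mem_ball] at h1
  linarith

/-- The boundary extension of `φ` is continuous on the closed half-plane (Carathéodory). -/
theorem continuousOn_bext : ContinuousOn φ.boundaryExtension (closure upperHalfPlaneSet) :=
  JordanDomain.continuousOn_boundaryExtension_holds E.toJordanDomain φ

/-- **No point of the closed half-plane is sent to `E.pt 1`** by the boundary extension of a
chordal uniformizer (`∞ ↦ E.pt 1` and the boundary correspondence is injective). -/
theorem boundaryExtension_ne_pt_one (hφ : E.IsChordalUniformizing φ) {z : ℂ} (hz : 0 ≤ z.im) :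
    φ.boundaryExtension z ≠ E.pt 1 := by
  obtain ⟨Φ, hΦ⟩ := JordanDomain.exists_isDiscExtension JordanDomain.exists_continuousOn_extension_holds
    (D := E.toJordanDomain) φ
  rcases hz.lt_or_eq with hlt | heq
  · rw [φ.boundaryExtension_eq (show z ∈ upperHalfPlaneSet from hlt)]
    exact fun h => E.pt_notMem_carrier 1 (h ▸ φ.mapsTo (show z ∈ upperHalfPlaneSet from hlt))
  · have hzre : z = ((z.re : ℝ) : ℂ) := Complex.ext (by simp) (by simp [← heq])
    rw [hzre, ← hΦ.apply_one_eq hφ.2]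
    exact hΦ.boundaryExtension_ofReal_ne z.re

/-- Along a sequence of `ℍ` converging in the closed half-plane, `φ` converges to the boundary
extension at the limit. -/
theorem tendsto_apply_of_tendsto {u : ℕ → ℂ} {w : ℂ} (hu : ∀ k, u k ∈ upperHalfPlaneSet)
    (hw : Tendsto u atTop (𝓝 w)) : Tendsto (fun k => φ (u k)) atTop (𝓝 (φ.boundaryExtension w)) := by
  have hwcl : w ∈ closure upperHalfPlaneSet :=
    mem_closure_of_tendsto hw (Eventually.of_forall fun k => hu k)
  have h1 : Tendsto u atTop (𝓝[closure upperHalfPlaneSet] w) :=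
    tendsto_nhdsWithin_iff.2 ⟨hw, Eventually.of_forall fun k => subset_closure (hu k)⟩
  have h2 := (continuousOn_bext (φ := φ) w hwcl).tendsto.comp h1
  refine h2.congr fun k => ?_
  simp only [Function.comp_apply, φ.boundaryExtension_eq (hu k)]

/-- **Conformal separation gives disjoint closures**: if `d ≤ dist (φ a) (φ b)` for all `a ∈ U`,
`b ∈ V` (`U, V ⊆ ℍ`, `d > 0`), then `closure U` and `closure V` are disjoint — at a common point
of the closures the boundary extension would be approached by both `φ '' U` and `φ '' V`. -/
theorem disjoint_closure_of_le_dist {U V : Set ℂ} (hU : U ⊆ upperHalfPlaneSet) (hV : V ⊆ upperHalfPlaneSet)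
    {d : ℝ} (hd : 0 < d) (hsep : ∀ a ∈ U, ∀ b ∈ V, d ≤ dist (φ a) (φ b)) :
    Disjoint (closure U) (closure V) := by
  rw [Set.disjoint_left]
  intro w hwU hwV
  have hwcl : w ∈ closure upperHalfPlaneSet := closure_mono hU hwU
  have hc : ContinuousWithinAt φ.boundaryExtension (closure upperHalfPlaneSet) w := continuousOn_bext w hwcl
  have hev : ∀ᶠ z in 𝓝[closure upperHalfPlaneSet] w,
      dist (φ.boundaryExtension z) (φ.boundaryExtension w) < d / 2 :=
    hc (ball_mem_nhds _ (half_pos hd))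
  rw [eventually_nhdsWithin_iff, Metric.eventually_nhds_iff] at hev
  obtain ⟨ε, hε, hball⟩ := hev
  obtain ⟨a, haU, haw⟩ := Metric.mem_closure_iff.1 hwU ε hε
  obtain ⟨b, hbV, hbw⟩ := Metric.mem_closure_iff.1 hwV ε hε
  have ha := hball (show dist a w < ε by rw [dist_comm]; exact haw) (subset_closure (hU haU))
  have hb := hball (show dist b w < ε by rw [dist_comm]; exact hbw) (subset_closure (hV hbV))
  rw [φ.boundaryExtension_eq (hU haU)] at ha
  rw [φ.boundaryExtension_eq (hV hbV)] at hb
  have h1 := hsep a haU b hbV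
  have h2 := dist_triangle_right (φ a) (φ b) (φ.boundaryExtension w)
  linarith

/-- **Disjoint closures give conformal separation**: for `X ⊆ closure ℍ` compact and `Y ⊆ ℍ`
with `X ∩ closure Y = ∅`, the images `φ '' (X ∩ ℍ)` and `φ '' Y` are a positive distance apart
(otherwise a pair of sequences with merging images converges — `Y` along a bounded subsequence,
by properness at `∞` — to two points of the closed half-plane with the same boundary value,
equal by injectivity of the boundary correspondence, a common point of `X` and `closure Y`). -/
theorem exists_le_dist_image (hφ : E.IsChordalUniformizing φ) {X Y : Set ℂ} (hX : IsCompact X)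
    (hXH : X ⊆ closure upperHalfPlaneSet) (hY : Y ⊆ upperHalfPlaneSet) (hdisj : Disjoint X (closure Y)) :
    ∃ d > (0 : ℝ), ∀ x ∈ X, x ∈ upperHalfPlaneSet → ∀ y ∈ Y, d ≤ dist (φ x) (φ y) := by
  by_contra hcon
  push Not at hcon
  -- sequences with merging images
  have hseq : ∀ k : ℕ, ∃ x ∈ X, x ∈ upperHalfPlaneSet ∧ ∃ y ∈ Y, dist (φ x) (φ y) < 1 / ((k : ℝ) + 1) := by
    intro k
    obtain ⟨x, hx, hxH, y, hy, hlt⟩ := hcon (1 / ((k : ℝ) + 1)) (by positivity)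
    exact ⟨x, hx, hxH, y, hy, hlt⟩
  choose x hxX hxH y hyY hxy using hseq
  -- `x` converges along a subsequence
  obtain ⟨x₀, hx₀, σ, hσ, hxlim⟩ := hX.tendsto_subseq hxX
  have hx₀cl : x₀ ∈ closure upperHalfPlaneSet := hXH hx₀
  have hφx : Tendsto (fun k => φ (x (σ k))) atTop (𝓝 (φ.boundaryExtension x₀)) :=
    tendsto_apply_of_tendsto (fun k => hxH (σ k)) hxlim
  have hdist0 : Tendsto (fun k => dist (φ (x (σ k))) (φ (y (σ k)))) atTop (𝓝 0) := by
    have h1 : Tendsto (fun k : ℕ => 1 / ((k : ℝ) + 1)) atTop (𝓝 0) := tendsto_one_div_add_atTop_nhds_zero_nat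
    have h2 : Tendsto (fun k : ℕ => 1 / (((σ k : ℕ) : ℝ) + 1)) atTop (𝓝 0) := h1.comp hσ.tendsto_atTop
    exact squeeze_zero (fun k => dist_nonneg) (fun k => (hxy (σ k)).le) h2
  have hφy : Tendsto (fun k => φ (y (σ k))) atTop (𝓝 (φ.boundaryExtension x₀)) := by
    rw [tendsto_iff_dist_tendsto_zero] at hφx ⊢
    refine squeeze_zero (fun k => dist_nonneg) (fun k => ?_) (by simpa using hdist0.add hφx)
    calc dist (φ (y (σ k))) (φ.boundaryExtension x₀)
        ≤ dist (φ (y (σ k))) (φ (x (σ k))) + dist (φ (x (σ k))) (φ.boundaryExtension x₀) := dist_triangle _ _ _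
      _ = dist (φ (x (σ k))) (φ (y (σ k))) + dist (φ (x (σ k))) (φ.boundaryExtension x₀) := by rw [dist_comm]
  -- the `y`-subsequence is bounded, by properness at `∞`
  set p : ℂ := φ.boundaryExtension x₀ with hp
  have hp1 : p ≠ E.pt 1 := boundaryExtension_ne_pt_one hφ (mem_closure_upperHalfPlaneSet_iff.1 hx₀cl)
  have hκ : 0 < dist p (E.pt 1) / 2 := half_pos (dist_pos.2 hp1)
  obtain ⟨R, hR⟩ := exists_norm_le_of_le_dist hφ hκ
  have hybd : ∀ᶠ k in atTop, ‖y (σ k)‖ ≤ R := by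
    have hev : ∀ᶠ k in atTop, dist (φ (y (σ k))) p < dist p (E.pt 1) / 2 :=
      (tendsto_iff_dist_tendsto_zero.1 hφy).eventually (gt_mem_nhds hκ)
    filter_upwards [hev] with k hk
    refine hR _ (hY (hyY (σ k))) ?_
    have := dist_triangle p (φ (y (σ k))) (E.pt 1)
    rw [dist_comm p (φ (y (σ k)))] at this
    linarith
  obtain ⟨k₀, hk₀⟩ := eventually_atTop.1 hybd
  -- a further convergent subsequence of `y`
  have hyin : ∀ k, y (σ (k + k₀)) ∈ closedBall (0 : ℂ) R := fun k => by
    rw [mem_closedBall, dist_zero_right]; exact hk₀ _ (Nat.le_add_left _ _)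
  obtain ⟨y₀, -, σ', hσ', hylim⟩ := (isCompact_closedBall (0 : ℂ) R).tendsto_subseq hyin
  have hφy' : Tendsto (fun k => φ (y (σ (σ' k + k₀)))) atTop (𝓝 (φ.boundaryExtension y₀)) :=
    tendsto_apply_of_tendsto (fun k => hY (hyY _)) hylim
  have hφy'' : Tendsto (fun k => φ (y (σ (σ' k + k₀)))) atTop (𝓝 p) :=
    hφy.comp ((tendsto_add_atTop_nat k₀).comp hσ'.tendsto_atTop)
  have heq : φ.boundaryExtension y₀ = p := tendsto_nhds_unique hφy' hφy''
  -- injectivity of the boundary correspondence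
  have hy₀cl : y₀ ∈ closure upperHalfPlaneSet :=
    mem_closure_of_tendsto hylim (Eventually.of_forall fun k => hY (hyY _))
  have hxy₀ : y₀ = x₀ :=
    JordanDomain.injOn_boundaryExtension φ (mem_closure_upperHalfPlaneSet_iff.1 hy₀cl) (mem_closure_upperHalfPlaneSet_iff.1 hx₀cl) heq
  -- `x₀ ∈ X ∩ closure Y`
  have hx₀Y : x₀ ∈ closure Y := by
    rw [← hxy₀]
    exact mem_closure_of_tendsto hylim (Eventually.of_forall fun k => hyY _)
  exact Set.disjoint_left.1 hdisj hx₀ hx₀Y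

/-- **DEEPNESS FROM EUCLIDEAN SEPARATION.**  For open `Gᴮ, G' ⊆ E` with `dist (E ∖ Gᴮ, G') ≥ d > 0`
and the hull `B := closure (ℍ ∖ φ.symm '' Gᴮ)` compact: `B` keeps a uniform positive distance
from `closure (φ.symm '' G')`, real points included. -/
theorem exists_pos_forall_le_infDist_hull {GB G' : Set ℂ} (hGB : GB ⊆ E.carrier) (hG' : G' ⊆ E.carrier)
    (hG'ne : G'.Nonempty) (hBc : IsCompact (closure (upperHalfPlaneSet \ φ.symm '' GB))) {d : ℝ} (hd : 0 < d)
    (hsep : ∀ a ∈ E.carrier \ GB, ∀ b ∈ G', d ≤ dist a b) :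
    ∃ r > (0 : ℝ), ∀ w ∈ closure (upperHalfPlaneSet \ φ.symm '' GB), r ≤ infDist w (closure (φ.symm '' G')) := by
  have hU : upperHalfPlaneSet \ φ.symm '' GB ⊆ upperHalfPlaneSet := fun _ h => h.1
  have hV : φ.symm '' G' ⊆ upperHalfPlaneSet := symm_image_subset hG'
  have hdisj : Disjoint (closure (upperHalfPlaneSet \ φ.symm '' GB)) (closure (φ.symm '' G')) := by
    refine disjoint_closure_of_le_dist hU hV hd fun a ha b hb => hsep (φ a) ⟨φ.mapsTo ha.1, fun h => ha.2 ?_⟩ (φ b) ?_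
    · exact (mem_symm_image_iff hGB ha.1).2 h
    · exact (mem_symm_image_iff hG' (hV hb)).1 hb
  obtain ⟨g, hg⟩ := hG'ne
  exact exists_pos_forall_le_infDist hBc isClosed_closure ⟨φ.symm g, subset_closure ⟨g, hg, rfl⟩⟩ hdisj

end Uniformizer

/-- **Registered carrier `stub_carvedReduction_uniformizer`** (crux item stmt-CriticalPhenomena-10472,
stub T-A′₂F `stub_carvedReduction_squeezeGeometry_domainsCoreF`, piece THE UNIFORMIZER TOOLKIT): a
compact set disjoint from a nonempty closed set keeps a uniform positive distance from it. -/
theorem stub_carvedReduction_uniformizer :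
    ∀ (K F : Set ℂ), IsCompact K → IsClosed F → F.Nonempty → Disjoint K F →
      ∃ r > (0 : ℝ), ∀ w ∈ K, r ≤ infDist w F :=
  fun _ _ hK hF hne hd => exists_pos_forall_le_infDist hK hF hne hd

end Summit.CriticalPhenomena.SAWScalingLimit.Theorems.ObservableToSLE.TypeLadder

end
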